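import Literature.Barriers.QuantumAdvantage.AaronsonChenOracle
import Literature.Computability.Complexity.TautMachine
import Literature.Computability.Complexity.ListFoldChecks
import Literature.Computability.Complexity.Transducers
import Mathlib.Tactic.DeriveFintype
import Mathlib.Data.Fintype.Option
import HarnessLib

/-!
# `TQBF ∈ PSPACE`, II: recognising the codes of closed prenex formulas in polynomial time

Second part of the membership half of Arora–Barak 2009, Thm. 4.13 ("`TQBF` is
`PSPACE`-complete"), for the tree's `TQBF` (`AaronsonChenOracle.lean`): the set of the codes
`PrenexQBF.encode ψ = boolPair ψ.quants (encodingPropForm.encode ψ.matrix)` of CLOSED and true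
prenex formulas. A decider therefore has to recognise, besides truth, that its input *is* such a
code and that the formula is closed (`PrenexQBF.IsClosed`: every variable of the matrix is below
the number of quantifiers) — the part of the algorithm that the textbook leaves implicit
("given a QBF `ψ`"). This file provides that test as an `FP` string function with an exact value:

* `validFn ∈ FP` (`validFn_mem_FP`), `validFn ψ.encode = [ψ.IsClosed]` (`validFn_encode`) and
  `validFn z = [true] → ∃ ψ, ψ.encode = z ∧ ψ.IsClosed` (`exists_of_validFn_eq_true`).

It is assembled in the brick algebra of the tree (`fanoutFn`, `andFn`, `eqPairFn`, `allFn`, …)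
from three tests:

* `pairOkFn z = [boolPair (fstF z) (sndF z) = z]` — `z` is a well-formed pair;
* `cwFn w = [w ∈ range encodingPropForm.encode]` — `w` is the code of a propositional formula.
  This is read off the tree's polynomial-time `TAUT` checker `TautProg.tautFn`
  (`TautMachine.lean`; `chkTaut (encode φ) y = ¬ φ(σ_y)`, `chkTaut w y = true` for every
  non-codeword `w`) WITHOUT a second parser, by a trick: the string surgery
  `negCodeFn ⟨u, c⟩ = ⟨1u, 10c⟩` turns the code of `φ` into the code of `¬φ`, so on a codeword the
  checker's verdicts on `w` and `negCodeFn w` differ, while a well-paired non-codeword `w` has a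
  non-codeword `negCodeFn w` (else `w` would encode the negand) and both verdicts are `true`;
* `closedFn z = [every variable of the matrix is < |quants|]`: a finite-state transducer `payT`
  extracts from the prefix code `PropForm.code φ` (`CNF.lean`: `var n ↦ 00·⟨bin n, ε⟩`,
  `const b ↦ 01b`, `¬ ↦ 10`, `∧ ↦ 110`, `∨ ↦ 111`) the list code of the variable occurrences
  (`payT_eval_code`), on which the list brick `allFn` checks `n < m` (`ltFn`) against
  `bin m = lenBinF quants`.

## References

* S. Arora, B. Barak, *Computational Complexity: A Modern Approach*, CUP 2009, Thm. 4.13,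
  Def. 4.10 ("all the variables of a QBF are bound by some quantifier"), §0.1 (codes)
  [AroraBarakCC2009].
-/

noncomputable section

namespace Literature.Barriers.QuantumAdvantage

open _root_.Computability Literature.Computability.Complexity Brick

namespace TQBFEval

/-! ### Well-formed pairs -/

/-- The test "`z` is a well-formed pair": `[boolPair (fstF z) (sndF z) = z]`. [folklore] -/
def pairOkFn : List Bool → List Bool :=
  eqPairFn ∘ fanoutFn (fanoutFn fstF sndF) id

/-- Value of `pairOkFn`. [folklore] -/
theorem pairOkFn_apply (z : List Bool) : pairOkFn z = [decide (boolPair (fstF z) (sndF z) = z)] := by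
  simp [pairOkFn, eqPairFn_boolPair]

/-- `pairOkFn` on a pair. [folklore] -/
@[simp] theorem pairOkFn_boolPair (a b : List Bool) : pairOkFn (boolPair a b) = [true] := by
  simp [pairOkFn_apply]

/-- `pairOkFn ∈ FP`. [folklore] -/
theorem pairOkFn_mem_FP : pairOkFn ∈ FP :=
  comp_mem_FP eqPairFn_mem_FP (fanoutFn_mem_FP (fanoutFn_mem_FP fstF_mem_FP sndF_mem_FP) OracleCompose.id_mem_FP)

/-- `pairOkFn` is one-bit. [folklore] -/
theorem oneBit_pairOkFn : OneBit pairOkFn := fun z => ⟨_, pairOkFn_apply z⟩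

/-! ### Codewords of propositional formulas, via the `TAUT` checker -/

/-- The code of the negation from the code of a formula, by string surgery:
`⟨u, c⟩ ↦ ⟨1u, 10c⟩` (`encode φ = ⟨1^{size φ}, code φ⟩`, `code (¬φ) = 10 · code φ`). [folklore] -/
def negCodeFn : List Bool → List Bool :=
  fanoutFn (List.cons true ∘ fstF) (List.cons true ∘ List.cons false ∘ sndF)

/-- Value of `negCodeFn`. [folklore] -/
theorem negCodeFn_apply (w : List Bool) :
    negCodeFn w = boolPair (true :: fstF w) (true :: false :: sndF w) := by
  simp [negCodeFn]

/-- On a codeword, `negCodeFn` gives the codeword of the negation. [folklore] -/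
theorem negCodeFn_encode (φ : PropForm ℕ) :
    negCodeFn (encodingPropForm.encode φ) = encodingPropForm.encode (PropForm.neg φ) := by
  change negCodeFn (boolPair (unaryEncodeNat φ.size) φ.code) =
    boolPair (unaryEncodeNat (φ.size + 1)) (true :: false :: φ.code)
  rw [negCodeFn_apply, fstF_boolPair, sndF_boolPair]
  rfl

/-- `negCodeFn ∈ FP`. [folklore] -/
theorem negCodeFn_mem_FP : negCodeFn ∈ FP :=
  fanoutFn_mem_FP (comp_mem_FP (cons_mem_FP true) fstF_mem_FP)
    (comp_mem_FP (cons_mem_FP true) (comp_mem_FP (cons_mem_FP false) sndF_mem_FP))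

/-- A well-paired string whose `negCodeFn` is a codeword is itself a codeword (of the negand).
[folklore] -/
theorem mem_range_of_negCodeFn_mem_range {w : List Bool} (hw : boolPair (fstF w) (sndF w) = w)
    (h : negCodeFn w ∈ Set.range encodingPropForm.encode) : w ∈ Set.range encodingPropForm.encode := by
  obtain ⟨ψ, hψ⟩ := h
  rw [negCodeFn_apply] at hψ
  change boolPair (unaryEncodeNat ψ.size) ψ.code = _ at hψ
  have hinj := boolPair_injective (a₁ := (unaryEncodeNat ψ.size, ψ.code))
    (a₂ := (true :: fstF w, true :: false :: sndF w)) hψ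
  simp only [Prod.mk.injEq] at hinj
  obtain ⟨h1, h2⟩ := hinj
  cases ψ with
  | var n => simp [PropForm.code] at h2
  | const b => simp [PropForm.code] at h2
  | conj φ₁ φ₂ => simp [PropForm.code] at h2
  | disj φ₁ φ₂ => simp [PropForm.code] at h2
  | neg φ =>
    simp only [PropForm.code, List.cons.injEq, true_and] at h2
    have h1' : unaryEncodeNat φ.size = fstF w := by
      simpa [PropForm.size, unaryEncodeNat] using h1
    refine ⟨φ, ?_⟩
    change boolPair (unaryEncodeNat φ.size) φ.code = w
    rw [h1', h2, hw]

/-- The `TAUT` checker's verdict on `f z` with the empty certificate, as a one-bit function: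
`[chkTaut (f z) []]`. [folklore] -/
def tautBit (f : List Bool → List Bool) : List Bool → List Bool :=
  TautProg.tautFn ∘ fanoutFn f (fun _ => [])

/-- Value of `tautBit`. [folklore] -/
theorem tautBit_apply (f : List Bool → List Bool) (z : List Bool) : tautBit f z = [chkTaut (f z) []] := by
  simp [tautBit, TautProg.tautFn_boolPair]

/-- `tautBit f ∈ FP` for `f ∈ FP`. [folklore] -/
theorem tautBit_mem_FP {f : List Bool → List Bool} (hf : f ∈ FP) : tautBit f ∈ FP :=
  comp_mem_FP TautProg.tautFn_mem_FP (fanoutFn_mem_FP hf (const_mem_FP _))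

/-- **The codeword test** for propositional formulas: well-paired, and the `TAUT` checker's
verdicts on the string and on its `negCodeFn` differ. [folklore] -/
def cwFn : List Bool → List Bool :=
  andFn pairOkFn (notFn (eqPairFn ∘ fanoutFn (tautBit id) (tautBit negCodeFn)))

/-- `cwFn ∈ FP`. [folklore] -/
theorem cwFn_mem_FP : cwFn ∈ FP :=
  andFn_mem_FP pairOkFn_mem_FP (notFn_mem_FP (comp_mem_FP eqPairFn_mem_FP
    (fanoutFn_mem_FP (tautBit_mem_FP OracleCompose.id_mem_FP) (tautBit_mem_FP negCodeFn_mem_FP))))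

/-- Raw value of `cwFn`. [folklore] -/
theorem cwFn_apply (w : List Bool) :
    cwFn w = [decide (boolPair (fstF w) (sndF w) = w) && !decide (chkTaut w [] = chkTaut (negCodeFn w) [])] := by
  have h : (eqPairFn ∘ fanoutFn (tautBit id) (tautBit negCodeFn)) w =
      [decide (chkTaut w [] = chkTaut (negCodeFn w) [])] := by
    simp [tautBit_apply, eqPairFn_boolPair]
  rw [cwFn, andFn_apply (pairOkFn_apply w) (notFn_apply h)]

/-- **`cwFn` accepts codewords.** [folklore] -/
theorem cwFn_encode (φ : PropForm ℕ) : cwFn (encodingPropForm.encode φ) = [true] := by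
  rw [cwFn_apply, negCodeFn_encode, chkTaut_encode, chkTaut_encode]
  have hp : boolPair (fstF (encodingPropForm.encode φ)) (sndF (encodingPropForm.encode φ)) =
      encodingPropForm.encode φ := by
    change boolPair (fstF (boolPair _ _)) (sndF (boolPair _ _)) = boolPair _ _
    rw [fstF_boolPair, sndF_boolPair]
  rw [decide_eq_true hp]
  have key : ∀ b c : Bool, c = !b → [true && !decide ((!b) = !c)] = [true] := by decide
  exact key _ _ rfl

/-- **`cwFn` rejects non-codewords.** [folklore] -/
theorem cwFn_of_not_mem_range {w : List Bool} (hw : w ∉ Set.range encodingPropForm.encode) : cwFn w = [false] := by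
  rw [cwFn_apply]
  by_cases hp : boolPair (fstF w) (sndF w) = w
  · have hneg : negCodeFn w ∉ Set.range encodingPropForm.encode :=
      fun h => hw (mem_range_of_negCodeFn_mem_range hp h)
    rw [chkTaut_of_not_mem_range hw, chkTaut_of_not_mem_range hneg]
    simp
  · rw [decide_eq_false hp]
    rfl

/-- **`cwFn` recognises exactly the codewords of formulas.** [folklore] -/
theorem cwFn_eq_true_iff (w : List Bool) : cwFn w = [true] ↔ w ∈ Set.range encodingPropForm.encode := by
  constructor
  · intro h
    by_contra hw
    rw [cwFn_of_not_mem_range hw] at h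
    exact absurd h (by decide)
  · rintro ⟨φ, rfl⟩
    exact cwFn_encode φ

/-- `cwFn` is one-bit. [folklore] -/
theorem oneBit_cwFn : OneBit cwFn := fun w => by
  by_cases hw : w ∈ Set.range encodingPropForm.encode
  · obtain ⟨φ, rfl⟩ := hw
    exact ⟨true, cwFn_encode φ⟩
  · exact ⟨false, cwFn_of_not_mem_range hw⟩

/-! ### The variables of a formula code: the payload transducer -/

/-- States of the payload transducer: at a token boundary (`tk`), after the first tag bit
(`t1 b`), skipping the value bit of a constant (`cst`), skipping the third tag bit of a binary
connective (`t11`), copying the pairs of a variable's payload (`vk`, pending first symbol).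
[folklore] -/
inductive PS
  | tk
  | t1 (b : Bool)
  | cst
  | t11
  | vk (o : Option Bool)
  deriving DecidableEq, Fintype

/-- Transition of the payload transducer. [folklore] -/
def payStep : PS → Bool → PS × List Bool
  | .tk, b => (.t1 b, [])
  | .t1 false, false => (.vk none, [])
  | .t1 false, true => (.cst, [])
  | .t1 true, false => (.tk, [])
  | .t1 true, true => (.t11, [])
  | .cst, _ => (.tk, [])
  | .t11, _ => (.tk, [])
  | .vk none, b => (.vk (some b), [b])
  | .vk (some b), b' => (if b = b' then .vk none else .tk, [b'])

/-- **The payload transducer**: on `PropForm.code φ` it emits the list code of the binary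
numerals of the variable occurrences of `φ` (`payT_eval_code`). [folklore] -/
def payT : FST PS Bool Bool where
  init := .tk
  step := payStep
  front := fun _ => []
  keep := fun _ => true

/-- The transition of `payT` (definitional). [folklore] -/
@[simp] theorem payT_step (s : PS) (b : Bool) : payT.step s b = payStep s b := rfl

/-- The variable occurrences of a formula, in prefix order. [folklore] -/
def varOcc : PropForm ℕ → List ℕ
  | .var n => [n]
  | .const _ => []
  | .neg φ => varOcc φ
  | .conj φ ψ => varOcc φ ++ varOcc ψ
  | .disj φ ψ => varOcc φ ++ varOcc ψ

/-- The words emitted for a formula: `⟨bin n, ε⟩` per variable occurrence `n`. [folklore] -/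
def emitVars (φ : PropForm ℕ) : List Bool :=
  (varOcc φ).flatMap fun n => boolPair (encodeNat n) []

/-- The emitted words form the list code of the numerals. [folklore] -/
theorem encList_map_encodeNat (l : List ℕ) :
    encList (l.map encodeNat) = l.flatMap fun n => boolPair (encodeNat n) [] := by
  induction l with
  | nil => rfl
  | cons n l ih =>
    rw [List.map_cons, encList_cons, List.flatMap_cons, ← ih]
    simp [boolPair]

/-- Copying a doubled string in the payload phase. [folklore] -/
theorem payT_run_vk_dbl (w rest : List Bool) :
    payT.run (.vk none) ((w.flatMap fun b => [b, b]) ++ rest) =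
      ((payT.run (.vk none) rest).1, (w.flatMap fun b => [b, b]) ++ (payT.run (.vk none) rest).2) := by
  induction w with
  | nil => rfl
  | cons b w ih => simp [FST.run_cons, payStep, ih]

/-- **The payload transducer on a formula code** (followed by anything): it emits the payload
words of the formula and returns to the token boundary. [folklore] -/
theorem payT_run_code : ∀ (φ : PropForm ℕ) (rest : List Bool),
    payT.run .tk (φ.code ++ rest) = ((payT.run .tk rest).1, emitVars φ ++ (payT.run .tk rest).2)
  | .var n, rest => by
    have h : (PropForm.var n).code ++ rest =
        false :: false :: (((encodeNat n).flatMap fun b => [b, b]) ++ (false :: true :: rest)) := by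
      simp [PropForm.code, boolPair]
    rw [h]
    simp [FST.run_cons, payStep, payT_run_vk_dbl, emitVars, varOcc, boolPair]
  | .const b, rest => by simp [PropForm.code, FST.run_cons, payStep, emitVars, varOcc]
  | .neg φ, rest => by
    simp [PropForm.code, FST.run_cons, payStep, payT_run_code φ rest, emitVars, varOcc]
  | .conj φ ψ, rest => by
    simp [PropForm.code, FST.run_cons, payStep, List.append_assoc, payT_run_code φ (ψ.code ++ rest),
      payT_run_code ψ rest, emitVars, varOcc]
  | .disj φ ψ, rest => by
    simp [PropForm.code, FST.run_cons, payStep, List.append_assoc, payT_run_code φ (ψ.code ++ rest),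
      payT_run_code ψ rest, emitVars, varOcc]

/-- **The payload transducer computes the list code of the variable occurrences.** [folklore] -/
theorem payT_eval_code (φ : PropForm ℕ) : payT.eval φ.code = encList ((varOcc φ).map encodeNat) := by
  have h := payT_run_code φ []
  rw [List.append_nil] at h
  simp only [FST.eval, show payT.init = PS.tk from rfl, h, FST.run_nil, List.append_nil,
    show payT.keep = fun _ => true from rfl, show payT.front = fun _ => [] from rfl, if_true, List.nil_append]
  rw [encList_map_encodeNat]
  rfl

/-- The variable bound of a formula is at most `m` iff all variable occurrences are `< m`.
[folklore] -/
theorem propFormVarBound_le_iff (m : ℕ) : ∀ φ : PropForm ℕ, propFormVarBound φ ≤ m ↔ ∀ n ∈ varOcc φ, n < m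
  | .var n => by simp [propFormVarBound, varOcc]
  | .const b => by simp [propFormVarBound, varOcc]
  | .neg φ => by simpa [propFormVarBound, varOcc] using propFormVarBound_le_iff m φ
  | .conj φ ψ => by
    simp only [propFormVarBound, max_le_iff, varOcc, List.mem_append, propFormVarBound_le_iff m φ,
      propFormVarBound_le_iff m ψ]
    exact ⟨fun h n hn => hn.elim (h.1 n) (h.2 n), fun h => ⟨fun n hn => h n (Or.inl hn), fun n hn => h n (Or.inr hn)⟩⟩
  | .disj φ ψ => by
    simp only [propFormVarBound, max_le_iff, varOcc, List.mem_append, propFormVarBound_le_iff m φ,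
      propFormVarBound_le_iff m ψ]
    exact ⟨fun h n hn => hn.elim (h.1 n) (h.2 n), fun h => ⟨fun n hn => h n (Or.inl hn), fun n hn => h n (Or.inr hn)⟩⟩

/-! ### Closedness -/

/-- `varLtFn ⟨x, a⟩ = [⟦a⟧ < ⟦x⟧]` (the comparison brick with swapped arguments). [folklore] -/
def varLtFn : List Bool → List Bool := ltFn ∘ fanoutFn sndF fstF

/-- Value of `varLtFn` on a pair. [folklore] -/
@[simp] theorem varLtFn_boolPair (x a : List Bool) : varLtFn (boolPair x a) = [decide (bitsToNat a < bitsToNat x)] := by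
  simp [varLtFn]

/-- `varLtFn ∈ FP`. [folklore] -/
theorem varLtFn_mem_FP : varLtFn ∈ FP := comp_mem_FP ltFn_mem_FP (fanoutFn_mem_FP sndF_mem_FP fstF_mem_FP)

/-- `varLtFn` is one-bit. [folklore] -/
theorem oneBit_varLtFn : OneBit varLtFn := oneBit_ltFn.comp _

/-- **The closedness test** on `z = ⟨quants, ⟨unary size, code⟩⟩`: every variable occurrence of the
matrix code is below `|quants|` (`allFn varLtFn` on `⟨bin |quants|, payT.eval code⟩`).
[cite: AroraBarakCC2009, Def. 4.10 ("all the variables of a QBF are bound by some quantifier")] -/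
def closedFn : List Bool → List Bool :=
  allFn varLtFn ∘ fanoutFn (lenBinF ∘ fstF) (payT.eval ∘ sndF ∘ sndF)

/-- `closedFn ∈ FP`. [folklore] -/
theorem closedFn_mem_FP : closedFn ∈ FP :=
  comp_mem_FP (allFn_mem_FP varLtFn_mem_FP oneBit_varLtFn)
    (fanoutFn_mem_FP (comp_mem_FP lenBinF_mem_FP fstF_mem_FP)
      (comp_mem_FP payT.polyTimeComputable_eval (comp_mem_FP sndF_mem_FP sndF_mem_FP)))

/-- `closedFn` is one-bit. [folklore] -/
theorem oneBit_closedFn : OneBit closedFn := (oneBit_allFn oneBit_varLtFn).comp _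

/-- **`closedFn` on the code of a prenex formula is its closedness.** [cite: AroraBarakCC2009, Def. 4.10] -/
theorem closedFn_encode (ψ : PrenexQBF) : closedFn ψ.encode = [decide ψ.IsClosed] := by
  change closedFn (boolPair ψ.quants (boolPair (unaryEncodeNat ψ.matrix.size) ψ.matrix.code)) = _
  simp only [closedFn, Function.comp_apply, fanoutFn_apply, fstF_boolPair, sndF_boolPair, lenBinF_apply,
    payT_eval_code]
  rw [allFn_boolPair oneBit_varLtFn, decNil_encList]
  congr 1
  simp only [List.forall_mem_map, varLtFn_boolPair, bitsToNat_encodeNat, List.cons.injEq, and_true,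
    decide_eq_true_eq]
  rw [Bool.decide_congr (propFormVarBound_le_iff ψ.quants.length ψ.matrix).symm]
  rfl

/-! ### The validity test -/

/-- **The validity test**: `z` is a well-formed pair `⟨quants, w⟩`, `w` is the code of a formula,
and the formula is closed under the prefix. [cite: AroraBarakCC2009, Def. 4.10] -/
def validFn : List Bool → List Bool :=
  andFn pairOkFn (andFn (cwFn ∘ sndF) closedFn)

/-- **`validFn ∈ FP`.** [cite: AroraBarakCC2009, §1.3 (closure of polynomial time under composition)] -/
theorem validFn_mem_FP : validFn ∈ FP :=
  andFn_mem_FP pairOkFn_mem_FP (andFn_mem_FP (comp_mem_FP cwFn_mem_FP sndF_mem_FP) closedFn_mem_FP)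

/-- `validFn` is one-bit. [folklore] -/
theorem oneBit_validFn : OneBit validFn :=
  oneBit_andFn oneBit_pairOkFn (oneBit_andFn (oneBit_cwFn.comp _) oneBit_closedFn)

/-- **`validFn` on the code of a prenex formula is its closedness.** [cite: AroraBarakCC2009, Def. 4.10] -/
theorem validFn_encode (ψ : PrenexQBF) : validFn ψ.encode = [decide ψ.IsClosed] := by
  have hz : ψ.encode = boolPair ψ.quants (encodingPropForm.encode ψ.matrix) := rfl
  have h1 : pairOkFn ψ.encode = [true] := by rw [hz, pairOkFn_boolPair]
  have h2 : (cwFn ∘ sndF) ψ.encode = [true] := by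
    rw [Function.comp_apply, hz, sndF_boolPair, cwFn_encode]
  rw [validFn, andFn_apply h1 (andFn_apply h2 (closedFn_encode ψ))]
  simp

/-- **A string passing the validity test is the code of a closed prenex formula.**
[cite: AroraBarakCC2009, Def. 4.10] -/
theorem exists_of_validFn_eq_true {z : List Bool} (h : validFn z = [true]) :
    ∃ ψ : PrenexQBF, ψ.encode = z ∧ ψ.IsClosed := by
  obtain ⟨b₂, hb₂⟩ := oneBit_cwFn (sndF z)
  obtain ⟨b₃, hb₃⟩ := oneBit_closedFn z
  have h2 : (cwFn ∘ sndF) z = [b₂] := hb₂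
  rw [validFn, andFn_apply (pairOkFn_apply z) (andFn_apply h2 hb₃), List.cons.injEq, Bool.and_eq_true,
    Bool.and_eq_true, decide_eq_true_eq] at h
  obtain ⟨⟨hp, rfl, rfl⟩, -⟩ := h
  obtain ⟨φ, hφ⟩ := (cwFn_eq_true_iff (sndF z)).1 hb₂
  have hz : (⟨fstF z, φ⟩ : PrenexQBF).encode = z := by
    change boolPair (fstF z) (encodingPropForm.encode φ) = z
    rw [hφ, hp]
  refine ⟨⟨fstF z, φ⟩, hz, ?_⟩
  have hv := closedFn_encode ⟨fstF z, φ⟩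
  rw [hz, hb₃] at hv
  simpa using hv

end TQBFEval

end Literature.Barriers.QuantumAdvantage
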